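import Summits.AtomisticToContinuum.FouriersLaw.Theorems.BondHeatUncertaintyExtensiveSnapshotIrreversibilityEnergyWindowSkeletonCoordinates

/-!
# Energy window, part T-b (file 2 of 3) — regularity of the skeleton objects: smooth in the skeleton,
jointly measurable in (skeleton, remainder)

Lineage `stmt-AtomisticToContinuum-9121` (`ExtensiveSnapshotIrreversibility`), K_fix half, leaf S3
`KernelTemperatureLipschitz`; record S3 ⟸ (Dˢ) ∧ (G1ℓ) ∧ (G1*ᶜᶜ) [Rᵇ], (G1ℓ) ⟸ (SWM) ∧ (JM),
(G1*ᶜᶜ) ⟸ (SWM) (glue parts S–V).  Cell decomp-a2c, lens «grading / quantitative ladder», generation 79,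
part T «SkeletonIdentities» (critic rows 1077 (d), 1086 (c), 1093 (g)) = five files: T-a
`…SkeletonVariation` (§1–§3, §6) → `…SkeletonJacobianMoments` (§4–§5) and T-b `…SkeletonCoordinates`
(§1–§3) → `…SkeletonRegularity` (§4) → `…SkeletonIdentities` (§5–§6); section numbers refer to the
part (T-a resp. T-b) as a whole.

THIS FILE (T-b §4) discharges the measurability / differentiability inputs of part S's level-`m`
Gaussian integration by parts (`wienerPair_skeleton_ibp_skorokhod`) for R's objects, at fixed `κ > 0`
and `s ∈ [0,1]`: `measurable_skelFlowMapAt_uncurry` (the flow map is jointly measurable in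
`(z, x, r)`: `pinnedChain_measurable_chainFlow` with the noise `chainNoise r + (skeleton ramp of x)`,
continuous in time, measurable in `(x, r)`); `contDiff_/measurable_skelJacAt_apply`,
`skelGramAt_apply`, `contDiff_/measurable_skelGramAt_apply`; `contDiff_/measurable_regInv_skelGramAt_apply`
(`det(Γ+κ) ≠ 0` from R `posDef_skelGramAt_add_smul`, then file 1's entrywise calculus);
`contDiff_/measurable_skelDepVec_apply` (`∂_z E`, R `contDiff_skelFlowMapAt_left/_uncurry` and Literature
`measurable_fderiv_apply_of_param`); and the controls / fields `skelCtrlArr`, `skelCtrlDep`,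
`skelFieldArr`, `skelFieldDep` (each `C^∞` in `x` at fixed `r`, jointly measurable in `(x, r)`).
File 3 (`…SkeletonIdentities`) combines these with file 1 §2 into the arrival / departure identities.
No instance / notation / option; no proof holes.
References: D. Nualart, The Malliavin Calculus and Related Topics (2006), Prop. 1.3.1, §2.3;
N. Cuneo, J.-P. Eckmann, M. Hairer, L. Rey-Bellet, Electron. J. Probab. 23 (2018), §3 eq. (3.4)–(3.6);
R. Horn, C. Johnson, Matrix Analysis, §0.8 (adjugate / Cramer). [folklore]
-/

noncomputable section

namespace Summit.AtomisticToContinuum.FouriersLaw.Theorems.ExtensiveSnapshotIrreversibility.EnergyWindow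

open MeasureTheory ProbabilityTheory Filter Topology Set
open scoped ENNReal NNReal Matrix ContDiff
open Literature.MathematicalPhysics.KineticTheory.HeatConduction
open Literature.Probability.Process

/-! ## 4. Regularity of the skeleton objects: smooth in the skeleton, jointly measurable -/

section Regularity

variable {ω₂ lam β γ : ℝ} (hω : 0 < ω₂) (hl : 0 ≤ lam) (hβ : 0 ≤ β) (hγ : 0 ≤ γ) (N : ℕ)
  (T_L T_R : ℝ)

include hω hl hβ hγ

/-- **The skeleton flow map is jointly measurable in (starting point, skeleton, remainder)**
(R `measurable_skelFlowMapAt` with the starting point as a measurable parameter: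
`pinnedChain_measurable_chainFlow`). [folklore] -/
theorem measurable_skelFlowMapAt_uncurry (s : ℝ) (m : ℕ) :
    Measurable fun q : PhaseSpace N × (PairSkeleton m × WienerPair) =>
      skelFlowMapAt ω₂ lam β γ N T_L T_R s m q.1 q.2.2 q.2.1 := by
  have hG : ∀ t, Measurable fun p : PairSkeleton m × WienerPair =>
      skelNoise ω₂ lam β γ N T_L T_R m p.2 p.1 t := by
    intro t
    have h1 : Measurable fun p : PairSkeleton m × WienerPair =>
        chainNoise N (ampL ω₂ lam β γ T_L) (ampR ω₂ lam β γ T_R) p.2 t :=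
      (measurable_chainNoise _ _ t).comp measurable_snd
    have h2 : Measurable fun p : PairSkeleton m × WienerPair =>
        IccExtend zero_le_one (skelForcing N m (ampL ω₂ lam β γ T_L) (ampR ω₂ lam β γ T_R) p.1)
          t := by
      have hx : Continuous fun x : PairSkeleton m =>
          (skelForcing N m (ampL ω₂ lam β γ T_L) (ampR ω₂ lam β γ T_R) x)
            (projIcc 0 1 zero_le_one t) :=
        (continuous_eval_const (projIcc 0 1 zero_le_one t)).comp (skelForcing N m _ _).continuous
      exact hx.measurable.comp measurable_fst
    exact h1.add h2
  exact pinnedChain_measurable_chainFlow hω hl hβ hγ N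
    (X := fun q : PhaseSpace N × (PairSkeleton m × WienerPair) => q.1)
    (G := fun q : PhaseSpace N × (PairSkeleton m × WienerPair) =>
      skelNoise ω₂ lam β γ N T_L T_R m q.2.2 q.2.1)
    measurable_fst (fun q => continuous_perturbedNoise (continuous_chainNoise _ _ q.2.2) _ q.2.1)
    (fun t => (hG t).comp measurable_snd) s

/-- The Jacobian entries are `C^∞` in the skeleton. [folklore] -/
theorem contDiff_skelJacAt_apply {s : ℝ} (hs : s ∈ Icc (0 : ℝ) 1) (m : ℕ) (z : PhaseSpace N)
    (r : WienerPair) (a : Fin N ⊕ Fin N) (j : Fin (2 ^ m) ⊕ Fin (2 ^ m)) :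
    ContDiff ℝ ∞ fun x => skelJacAt ω₂ lam β γ N T_L T_R s m z r x a j := by
  have h1 : ContDiff ℝ ∞ fun x =>
      fderiv ℝ (skelFlowMapAt ω₂ lam β γ N T_L T_R s m z r) x (basisX m j) :=
    ((contDiff_skelFlowMapAt hω hl hβ hγ N T_L T_R hs m z r).fderiv_right (by simp)).clm_apply
      contDiff_const
  exact (contDiff_coordV_apply N a).comp h1

/-- The Jacobian entries are jointly measurable in (skeleton, remainder). [folklore] -/
theorem measurable_skelJacAt_apply {s : ℝ} (hs : s ∈ Icc (0 : ℝ) 1) (m : ℕ) (z : PhaseSpace N)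
    (a : Fin N ⊕ Fin N) (j : Fin (2 ^ m) ⊕ Fin (2 ^ m)) :
    Measurable fun p : PairSkeleton m × WienerPair =>
      skelJacAt ω₂ lam β γ N T_L T_R s m z p.2 p.1 a j :=
  (continuous_coordV_apply N a).measurable.comp
    (measurable_fderiv_skelFlowMapAt_apply hω hl hβ hγ N T_L T_R hs m z (basisX m j))

omit hω hl hβ hγ in
/-- The entries of `Γ = 2^{-m} J Jᵀ` as explicit sums. [folklore] -/
theorem skelGramAt_apply (s : ℝ) (m : ℕ) (z : PhaseSpace N) (r : WienerPair) (x : PairSkeleton m)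
    (a a' : Fin N ⊕ Fin N) :
    skelGramAt ω₂ lam β γ N T_L T_R s m z r x a a' =
      ((2 : ℝ) ^ m)⁻¹ * ∑ j, skelJacAt ω₂ lam β γ N T_L T_R s m z r x a j *
        skelJacAt ω₂ lam β γ N T_L T_R s m z r x a' j := by
  simp only [skelGramAt, Matrix.smul_apply, Matrix.mul_apply, Matrix.transpose_apply, smul_eq_mul]

/-- The Gram entries are `C^∞` in the skeleton. [folklore] -/
theorem contDiff_skelGramAt_apply {s : ℝ} (hs : s ∈ Icc (0 : ℝ) 1) (m : ℕ) (z : PhaseSpace N)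
    (r : WienerPair) (a a' : Fin N ⊕ Fin N) :
    ContDiff ℝ ∞ fun x => skelGramAt ω₂ lam β γ N T_L T_R s m z r x a a' := by
  simp only [skelGramAt_apply]
  exact contDiff_const.mul (ContDiff.sum fun j _ =>
    (contDiff_skelJacAt_apply hω hl hβ hγ N T_L T_R hs m z r a j).mul
      (contDiff_skelJacAt_apply hω hl hβ hγ N T_L T_R hs m z r a' j))

/-- The Gram entries are jointly measurable in (skeleton, remainder). [folklore] -/
theorem measurable_skelGramAt_apply {s : ℝ} (hs : s ∈ Icc (0 : ℝ) 1) (m : ℕ) (z : PhaseSpace N)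
    (a a' : Fin N ⊕ Fin N) :
    Measurable fun p : PairSkeleton m × WienerPair =>
      skelGramAt ω₂ lam β γ N T_L T_R s m z p.2 p.1 a a' := by
  simp only [skelGramAt_apply]
  exact (Finset.measurable_sum _ fun j _ =>
    (measurable_skelJacAt_apply hω hl hβ hγ N T_L T_R hs m z a j).mul
      (measurable_skelJacAt_apply hω hl hβ hγ N T_L T_R hs m z a' j)).const_mul _

/-- The entries of the regularised inverse `(Γ+κ)⁻¹`, `κ > 0`, are `C^∞` in the skeleton
(`det (Γ+κ) > 0` by R `posDef_skelGramAt_add_smul`; §3). [folklore] -/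
theorem contDiff_regInv_skelGramAt_apply {s : ℝ} (hs : s ∈ Icc (0 : ℝ) 1) (m : ℕ) {κ : ℝ}
    (hκ : 0 < κ) (z : PhaseSpace N) (r : WienerPair) (k l : Fin N ⊕ Fin N) :
    ContDiff ℝ ∞ fun x => regInv (skelGramAt ω₂ lam β γ N T_L T_R s m z r x) κ k l := by
  unfold regInv
  refine contDiff_inv_apply_of_entries (fun a a' => ?_) (fun x => ?_) k l
  · simp only [Matrix.add_apply, Matrix.smul_apply, smul_eq_mul]
    exact (contDiff_skelGramAt_apply hω hl hβ hγ N T_L T_R hs m z r a a').add contDiff_const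
  · exact (posDef_skelGramAt_add_smul hκ z r x).det_pos.ne'

/-- The entries of `(Γ+κ)⁻¹` are jointly measurable in (skeleton, remainder) (§3). [folklore] -/
theorem measurable_regInv_skelGramAt_apply {s : ℝ} (hs : s ∈ Icc (0 : ℝ) 1) (m : ℕ) (κ : ℝ)
    (z : PhaseSpace N) (k l : Fin N ⊕ Fin N) :
    Measurable fun p : PairSkeleton m × WienerPair =>
      regInv (skelGramAt ω₂ lam β γ N T_L T_R s m z p.2 p.1) κ k l := by
  unfold regInv
  refine measurable_inv_apply_of_entries (fun a a' => ?_) k l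
  simp only [Matrix.add_apply, Matrix.smul_apply, smul_eq_mul]
  exact (measurable_skelGramAt_apply hω hl hβ hγ N T_L T_R hs m z a a').add measurable_const

/-- The departure vector `V = coordV (∂_z E[e_{p_b}])` is `C^∞` in the skeleton (joint smoothness
of the flow in (starting point, skeleton): R `contDiff_skelFlowMapAt_uncurry`). [folklore] -/
theorem contDiff_skelDepVec_apply {s : ℝ} (hs : s ∈ Icc (0 : ℝ) 1) (m : ℕ) (b : Fin N)
    (z : PhaseSpace N) (r : WienerPair) (a : Fin N ⊕ Fin N) :
    ContDiff ℝ ∞ fun x => skelDepVec ω₂ lam β γ N T_L T_R s m b z r x a := by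
  have hu0 := (contDiff_skelFlowMapAt_uncurry hω hl hβ hγ N T_L T_R hs m r).comp
    ((contDiff_snd (𝕜 := ℝ) (E := PairSkeleton m) (F := PhaseSpace N) (n := ∞)).prodMk
      contDiff_fst)
  have hfun : (Function.uncurry fun (x : PairSkeleton m) (z' : PhaseSpace N) =>
      skelFlowMapAt ω₂ lam β γ N T_L T_R s m z' r x) =
      (fun p : PhaseSpace N × PairSkeleton m => skelFlowMapAt ω₂ lam β γ N T_L T_R s m p.1 r p.2) ∘
        fun p : PairSkeleton m × PhaseSpace N => (p.2, p.1) := rfl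
  have hu : ContDiff ℝ ∞ (Function.uncurry fun (x : PairSkeleton m) (z' : PhaseSpace N) =>
      skelFlowMapAt ω₂ lam β γ N T_L T_R s m z' r x) := by
    rw [hfun]; exact hu0
  have h1 : ContDiff ℝ ∞ fun x : PairSkeleton m =>
      fderiv ℝ (fun z' => skelFlowMapAt ω₂ lam β γ N T_L T_R s m z' r x) z :=
    hu.fderiv (contDiff_const (c := z)) (by simp)
  have h2 : ContDiff ℝ ∞ fun x : PairSkeleton m =>
      fderiv ℝ (fun z' => skelFlowMapAt ω₂ lam β γ N T_L T_R s m z' r x) z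
        ((0 : Fin N → ℝ), Pi.single b 1) :=
    h1.clm_apply contDiff_const
  exact (contDiff_coordV_apply N a).comp h2

/-- The departure vector is jointly measurable in (skeleton, remainder) (difference quotients in
the starting point of the jointly measurable flow map, `measurable_fderiv_apply_of_param`).
[folklore] -/
theorem measurable_skelDepVec_apply {s : ℝ} (hs : s ∈ Icc (0 : ℝ) 1) (m : ℕ) (b : Fin N)
    (z : PhaseSpace N) (a : Fin N ⊕ Fin N) :
    Measurable fun p : PairSkeleton m × WienerPair =>
      skelDepVec ω₂ lam β γ N T_L T_R s m b z p.2 p.1 a := by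
  have hF := measurable_skelFlowMapAt_uncurry hω hl hβ hγ N T_L T_R s m
  have hd : ∀ (rx : PairSkeleton m × WienerPair) (z' : PhaseSpace N),
      DifferentiableAt ℝ (fun y : PhaseSpace N =>
        skelFlowMapAt ω₂ lam β γ N T_L T_R s m y rx.2 rx.1) z' := fun rx z' =>
    (contDiff_skelFlowMapAt_left hω hl hβ hγ N T_L T_R hs m rx.2 rx.1).differentiable (by simp) z'
  have h : Measurable fun q : PhaseSpace N × (PairSkeleton m × WienerPair) =>
      fderiv ℝ (fun y : PhaseSpace N => skelFlowMapAt ω₂ lam β γ N T_L T_R s m y q.2.2 q.2.1) q.1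
        ((0 : Fin N → ℝ), Pi.single b 1) :=
    measurable_fderiv_apply_of_param
      (fun q : PhaseSpace N × (PairSkeleton m × WienerPair) =>
        skelFlowMapAt ω₂ lam β γ N T_L T_R s m q.1 q.2.2 q.2.1) hF hd _
  have hι : Measurable fun p : PairSkeleton m × WienerPair =>
      ((z, p) : PhaseSpace N × (PairSkeleton m × WienerPair)) :=
    measurable_const.prodMk measurable_id
  -- elaborate the compositions WITHOUT expected type (the unifier would otherwise unfold `fderiv`)
  have h2 := h.comp hι
  have h3 := (continuous_coordV_apply N a).measurable.comp h2
  exact h3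

/-- The arrival control `a = (Γ+κ)⁻¹ e_{p_b}` is `C^∞` in the skeleton. [folklore] -/
theorem contDiff_skelCtrlArr_apply {s : ℝ} (hs : s ∈ Icc (0 : ℝ) 1) (m : ℕ) {κ : ℝ} (hκ : 0 < κ)
    (b : Fin N) (z : PhaseSpace N) (r : WienerPair) (a : Fin N ⊕ Fin N) :
    ContDiff ℝ ∞ fun x => skelCtrlArr ω₂ lam β γ N T_L T_R s m κ b z r x a := by
  simp only [skelCtrlArr, Matrix.mulVec, dotProduct]
  exact ContDiff.sum fun a' _ =>
    (contDiff_regInv_skelGramAt_apply hω hl hβ hγ N T_L T_R hs m hκ z r a a').mul contDiff_const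

/-- The arrival control is jointly measurable in (skeleton, remainder). [folklore] -/
theorem measurable_skelCtrlArr_apply {s : ℝ} (hs : s ∈ Icc (0 : ℝ) 1) (m : ℕ) (κ : ℝ) (b : Fin N)
    (z : PhaseSpace N) (a : Fin N ⊕ Fin N) :
    Measurable fun p : PairSkeleton m × WienerPair =>
      skelCtrlArr ω₂ lam β γ N T_L T_R s m κ b z p.2 p.1 a := by
  simp only [skelCtrlArr, Matrix.mulVec, dotProduct]
  exact Finset.measurable_sum _ fun a' _ =>
    (measurable_regInv_skelGramAt_apply hω hl hβ hγ N T_L T_R hs m κ z a a').mul measurable_const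

/-- The departure control `a' = (Γ+κ)⁻¹ V` is `C^∞` in the skeleton. [folklore] -/
theorem contDiff_skelCtrlDep_apply {s : ℝ} (hs : s ∈ Icc (0 : ℝ) 1) (m : ℕ) {κ : ℝ} (hκ : 0 < κ)
    (b : Fin N) (z : PhaseSpace N) (r : WienerPair) (a : Fin N ⊕ Fin N) :
    ContDiff ℝ ∞ fun x => skelCtrlDep ω₂ lam β γ N T_L T_R s m κ b z r x a := by
  simp only [skelCtrlDep, Matrix.mulVec, dotProduct]
  exact ContDiff.sum fun a' _ =>
    (contDiff_regInv_skelGramAt_apply hω hl hβ hγ N T_L T_R hs m hκ z r a a').mul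
      (contDiff_skelDepVec_apply hω hl hβ hγ N T_L T_R hs m b z r a')

/-- The departure control is jointly measurable in (skeleton, remainder). [folklore] -/
theorem measurable_skelCtrlDep_apply {s : ℝ} (hs : s ∈ Icc (0 : ℝ) 1) (m : ℕ) (κ : ℝ) (b : Fin N)
    (z : PhaseSpace N) (a : Fin N ⊕ Fin N) :
    Measurable fun p : PairSkeleton m × WienerPair =>
      skelCtrlDep ω₂ lam β γ N T_L T_R s m κ b z p.2 p.1 a := by
  simp only [skelCtrlDep, Matrix.mulVec, dotProduct]
  exact Finset.measurable_sum _ fun a' _ =>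
    (measurable_regInv_skelGramAt_apply hω hl hβ hγ N T_L T_R hs m κ z a a').mul
      (measurable_skelDepVec_apply hω hl hβ hγ N T_L T_R hs m b z a')

/-- The arrival field `u = Jᵀ a` is `C^∞` in the skeleton. [folklore] -/
theorem contDiff_skelFieldArr_apply {s : ℝ} (hs : s ∈ Icc (0 : ℝ) 1) (m : ℕ) {κ : ℝ} (hκ : 0 < κ)
    (b : Fin N) (z : PhaseSpace N) (r : WienerPair) (j : Fin (2 ^ m) ⊕ Fin (2 ^ m)) :
    ContDiff ℝ ∞ fun x => skelFieldArr ω₂ lam β γ N T_L T_R s m κ b z r x j := by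
  simp only [skelFieldArr, Matrix.vecMul, dotProduct]
  exact ContDiff.sum fun a _ =>
    (contDiff_skelCtrlArr_apply hω hl hβ hγ N T_L T_R hs m hκ b z r a).mul
      (contDiff_skelJacAt_apply hω hl hβ hγ N T_L T_R hs m z r a j)

/-- The arrival field is jointly measurable in (skeleton, remainder). [folklore] -/
theorem measurable_skelFieldArr_apply {s : ℝ} (hs : s ∈ Icc (0 : ℝ) 1) (m : ℕ) (κ : ℝ) (b : Fin N)
    (z : PhaseSpace N) (j : Fin (2 ^ m) ⊕ Fin (2 ^ m)) :
    Measurable fun p : PairSkeleton m × WienerPair =>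
      skelFieldArr ω₂ lam β γ N T_L T_R s m κ b z p.2 p.1 j := by
  simp only [skelFieldArr, Matrix.vecMul, dotProduct]
  exact Finset.measurable_sum _ fun a _ =>
    (measurable_skelCtrlArr_apply hω hl hβ hγ N T_L T_R hs m κ b z a).mul
      (measurable_skelJacAt_apply hω hl hβ hγ N T_L T_R hs m z a j)

/-- The departure field `u' = Jᵀ a'` is `C^∞` in the skeleton. [folklore] -/
theorem contDiff_skelFieldDep_apply {s : ℝ} (hs : s ∈ Icc (0 : ℝ) 1) (m : ℕ) {κ : ℝ} (hκ : 0 < κ)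
    (b : Fin N) (z : PhaseSpace N) (r : WienerPair) (j : Fin (2 ^ m) ⊕ Fin (2 ^ m)) :
    ContDiff ℝ ∞ fun x => skelFieldDep ω₂ lam β γ N T_L T_R s m κ b z r x j := by
  simp only [skelFieldDep, Matrix.vecMul, dotProduct]
  exact ContDiff.sum fun a _ =>
    (contDiff_skelCtrlDep_apply hω hl hβ hγ N T_L T_R hs m hκ b z r a).mul
      (contDiff_skelJacAt_apply hω hl hβ hγ N T_L T_R hs m z r a j)

/-- The departure field is jointly measurable in (skeleton, remainder). [folklore] -/
theorem measurable_skelFieldDep_apply {s : ℝ} (hs : s ∈ Icc (0 : ℝ) 1) (m : ℕ) (κ : ℝ) (b : Fin N)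
    (z : PhaseSpace N) (j : Fin (2 ^ m) ⊕ Fin (2 ^ m)) :
    Measurable fun p : PairSkeleton m × WienerPair =>
      skelFieldDep ω₂ lam β γ N T_L T_R s m κ b z p.2 p.1 j := by
  simp only [skelFieldDep, Matrix.vecMul, dotProduct]
  exact Finset.measurable_sum _ fun a _ =>
    (measurable_skelCtrlDep_apply hω hl hβ hγ N T_L T_R hs m κ b z a).mul
      (measurable_skelJacAt_apply hω hl hβ hγ N T_L T_R hs m z a j)

end Regularity

end Summit.AtomisticToContinuum.FouriersLaw.Theorems.ExtensiveSnapshotIrreversibility.EnergyWindow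

end
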